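import Summits.ResolutionOfSingularities.ResolutionOfSingularities.Theorems.FrobeniusClosingPatchingRelPerfectDepthSNCPointwise
import Literature.AlgebraicGeometry.Resolution.SncParameterExchange
import HarnessLib

/-!
# Crux `PatchingRelPerfect` (stmt-ResolutionOfSingularities-16161), chain W5.2 — T6-E1b residual `LegalScopedDivisorReduction₃`,
# PHASE 2 closer (2b), brick B3′a: WHEN IS A CURVE CENTRE NORMAL CROSSINGS WITH THE BOUNDARY — two pointwise exchange lemmas

[OURS · L1 W5.2 · res-L1-w52-lead-1 g5, hand #3b; plan `L/res-L1-w52-lead-1/PHASE2-SEPARATION-GAME.md` v2 §v2 «obstruction lemma»]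
Replaces the role of NO printed item; NOT a statement of the manuscript under review; fact-free.

The curve moves of the separation game blow up regular curves `Γ ⊆ X ∩ F` on the host `X`; `HostState.step` (brick B1) asks that the
centre have normal crossings with the boundary, `HasSNCWith (boundaryOf L) 𝓘(Γ)`, i.e. `SNCWithAt (boundaryOf L) 𝓘(Γ) x` at every point
(res-D-pv-009's pointwise form, `…DepthSNCPointwise`). This file gives the two LOCAL CRITERIA the game uses, as parameter exchanges in
the regular local ring `𝒪_{E,x}` (Kollár 3.104 Step 2.1 pattern; tree `rsop_update`, `exists_isUnit_coeff_of_not_mem`):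

* `SNCWithAt.centre_of_members` (GEN₀) — if `𝓘(Γ)_x` is the sum of the stalks of SOME boundary members through `x` (a stratum: the
  DOUBLE CURVE `Γ = F₁ ∩ F₂`), the boundary is n.c. with `𝓘(Γ)` at `x`;
* `SNCWithAt.centre_of_members_sup_span` (GEN) — if `𝓘(Γ)_x = (Σ stalks of some members through x) + (g)` with `g` INDEPENDENT modulo
  `𝔪_x²` of the equations of ALL boundary members through `x`, the boundary is n.c. with `𝓘(Γ)` at `x`.  Instances: a SIMPLE trace curve
  `Γ = X ∩ F₁` (`𝓘(Γ)_x = (f₁) + (z)`, `z` the host equation, legal iff `z ∉ (f₁, f₂) + 𝔪²` for the at most one other member `F₂ ∋ x`,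
  i.e. iff the traces of `F₁, F₂` on `X` cross transversally at `x`; with THREE members through `x` the hypothesis fails — the
  obstruction of plan v2 (ii-d)); a TANGENCY curve (`𝓘(Γ)_x = (f₁) + (g)`, any other member through `x` transversal to `Γ`).
* `hasSNCWith_of_pointwise` — the global wrapper: nothing is asked off `V(C)`.

AI-written; AI review is weaker than expert review.

## References
* J. Kollár, *Lectures on Resolution of Singularities* (2007), 3.104 Step 2.1, Def. 3.24–3.25. [Kollar2007]
* H. Matsumura, *Commutative Ring Theory* (1986), Thm. 14.2. [Matsumura1987]
-/

-- `Summit.<Summit>.<Sub>.Theorems` with `Sub = Summit` (single-conjunct summit, D-0017)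
set_option linter.dupNamespace false

noncomputable section

open CategoryTheory CategoryTheory.Limits AlgebraicGeometry TopologicalSpace IsLocalRing
open Literature.AlgebraicGeometry.Resolution Scheme.IdealSheafData

namespace Summit.ResolutionOfSingularities.ResolutionOfSingularities.Theorems

universe u

namespace DepthSNC

namespace SNCWithAt

variable {X : Scheme.{u}} {ℬ : List X.IdealSheafData} {C : X.IdealSheafData} {x : X}

/-- [OURS · L1 W5.2] **(GEN₀) A stratum of boundary members through `x` is a normal-crossings centre at `x`**: if the boundary
`ℬ` has simple normal crossings at `x` and `C_x = Σ_{D ∈ A} D_x` for a set `A` of members through `x`, then `ℬ` has simple normal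
crossings WITH `C` at `x` (the same parameters; `C_x` is generated by the labels of `A`). The double curves `Γ = F₁ ∩ F₂` of the
separation game. [cite: Kollar2007, Def. 3.25] -/
theorem centre_of_members (hℬ : SNCWithAt ℬ ⊤ x) (A : Set X.IdealSheafData) (hA : ∀ D ∈ A, D ∈ ℬ ∧ x ∈ D.support)
    (hC : stalkIdeal C x = ⨆ D ∈ A, stalkIdeal D x) : SNCWithAt ℬ C x := by
  classical
  obtain ⟨hreg, d, v, hd, hv, ⟨ι, hι, hιD⟩, -⟩ := hℬ
  refine ⟨hreg, d, v, hd, hv, ⟨ι, hι, hιD⟩, fun _ => ⟨ι '' {D' | D'.1 ∈ A}, ?_⟩⟩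
  rw [hC]
  exact (span_image_labels_eq v ι hιD A hA).symm
where
  /-- the span of the labels of the members in `A` is the sum of their stalks -/
  span_image_labels_eq {d : ℕ} (v : Fin d → X.presheaf.stalk x)
      (ι : {D : X.IdealSheafData // D ∈ ℬ ∧ x ∈ D.support} → Fin d)
      (hιD : ∀ D, stalkIdeal D.1 x = Ideal.span {v (ι D)}) (A : Set X.IdealSheafData)
      (hA : ∀ D ∈ A, D ∈ ℬ ∧ x ∈ D.support) :
      Ideal.span (v '' (ι '' {D' | D'.1 ∈ A})) = ⨆ D ∈ A, stalkIdeal D x := by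
    apply le_antisymm
    · rw [Ideal.span_le]
      rintro _ ⟨_, ⟨D', hD', rfl⟩, rfl⟩
      have hmem : v (ι D') ∈ stalkIdeal D'.1 x := by rw [hιD D']; exact Ideal.mem_span_singleton_self _
      exact (le_iSup₂ (f := fun D (_ : D ∈ A) => stalkIdeal D x) D'.1 hD') hmem
    · refine iSup₂_le fun D hDA => ?_
      let D' : {D : X.IdealSheafData // D ∈ ℬ ∧ x ∈ D.support} := ⟨D, hA D hDA⟩
      rw [show stalkIdeal D x = Ideal.span {v (ι D')} from hιD D']
      exact Ideal.span_mono (Set.singleton_subset_iff.mpr ⟨ι D', ⟨D', hDA, rfl⟩, rfl⟩)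

/-- [OURS · L1 W5.2] **(GEN) A stratum PLUS ONE INDEPENDENT EQUATION is a normal-crossings centre at `x`**: if the boundary `ℬ` has
simple normal crossings at `x ∈ V(C)` and `C_x = Σ_{D ∈ A} D_x + (g)` with `A` a set of members through `x` and `g` INDEPENDENT modulo `𝔪_x²`
of the equations of ALL members through `x` (`g ∉ Σ_{D ∋ x} D_x + 𝔪_x²`), then `ℬ` has simple normal crossings WITH `C` at `x`: write
`g = Σ aᵢ vᵢ` in the adapted parameters; a label free of every member carries a unit coefficient (`exists_isUnit_coeff_of_not_mem`), and
exchanging that parameter for `g` (`rsop_update`) keeps every member a coordinate hyperplane while making `C_x` a coordinate subspace.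
The simple trace curves `Γ = X ∩ F₁` (`g = z`, the host equation) and the tangency curves of the separation game.
[cite: Kollar2007, 3.104 Step 2.1] [cite: Matsumura1987, Thm. 14.2] -/
theorem centre_of_members_sup_span (hℬ : SNCWithAt ℬ ⊤ x) (hxC : x ∈ C.support) (A : Set X.IdealSheafData)
    (hA : ∀ D ∈ A, D ∈ ℬ ∧ x ∈ D.support) (g : X.presheaf.stalk x)
    (hC : stalkIdeal C x = (⨆ D ∈ A, stalkIdeal D x) ⊔ Ideal.span {g})
    (hg : g ∉ (⨆ (D : X.IdealSheafData) (_ : D ∈ ℬ ∧ x ∈ D.support), stalkIdeal D x) ⊔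
      maximalIdeal (X.presheaf.stalk x) ^ 2) :
    SNCWithAt ℬ C x := by
  classical
  obtain ⟨hreg, d, v, hd, hv, ⟨ι, hι, hιD⟩, -⟩ := hℬ
  haveI := hreg
  -- `g ∈ 𝔪_x = (v)`: write `g = Σ cᵢ vᵢ`
  have hgm : g ∈ maximalIdeal (X.presheaf.stalk x) := by
    have h1 : g ∈ stalkIdeal C x := by rw [hC]; exact Ideal.mem_sup_right (Ideal.mem_span_singleton_self g)
    exact (mem_support_iff_stalkIdeal_le C x).mp hxC h1
  obtain ⟨c, hc⟩ := Ideal.mem_span_range_iff_exists_fun.mp (by rw [hv]; exact hgm : g ∈ Ideal.span (Set.range v))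
  -- the labels of the members through `x`
  set T : Set (Fin d) := Set.range ι with hT
  have hTle : Ideal.span (v '' T) ≤ ⨆ (D : X.IdealSheafData) (_ : D ∈ ℬ ∧ x ∈ D.support), stalkIdeal D x := by
    rw [Ideal.span_le]
    rintro _ ⟨_, ⟨D', rfl⟩, rfl⟩
    have hmem : v (ι D') ∈ stalkIdeal D'.1 x := by rw [hιD D']; exact Ideal.mem_span_singleton_self _
    exact (le_iSup₂ (f := fun D (_ : D ∈ ℬ ∧ x ∈ D.support) => stalkIdeal D x) D'.1 D'.2) hmem
  have hnot : ∑ i ∈ (Finset.univ : Finset (Fin d)), c i * v i ∉ Ideal.span (v '' T) ⊔ maximalIdeal (X.presheaf.stalk x) ^ 2 := by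
    rw [hc]; exact fun h => hg (sup_le_sup_right hTle _ h)
  obtain ⟨i₀, -, hi₀T, hu⟩ := exists_isUnit_coeff_of_not_mem v hv Finset.univ T c hnot
  -- exchange `v i₀ ↦ g`
  set v' := Function.update v i₀ (∑ i ∈ Finset.univ, c i * v i) with hv'
  have hv'span := (rsop_update v hv Finset.univ c (Finset.mem_univ i₀) hu).1
  have hv'i₀ : v' i₀ = g := by rw [hv', Function.update_self, hc]
  have hne : ∀ D', ι D' ≠ i₀ := fun D' h => hi₀T ⟨D', h⟩
  have hv'ι : ∀ D', v' (ι D') = v (ι D') := fun D' => by rw [hv', Function.update_of_ne (hne D')]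
  refine ⟨hreg, d, v', hd, hv'span, ⟨ι, hι, fun D' => by rw [hιD D', hv'ι D']⟩,
    fun _ => ⟨insert i₀ (ι '' {D' | D'.1 ∈ A}), ?_⟩⟩
  rw [hC, Set.image_insert_eq, Ideal.span_insert, hv'i₀, sup_comm]
  congr 1
  -- the stratum part: `Σ_{D ∈ A} D_x = span (v' '' labels(A)) = span (v '' labels(A))`
  have himg : v' '' (ι '' {D' | D'.1 ∈ A}) = v '' (ι '' {D' | D'.1 ∈ A}) := by
    refine Set.image_congr fun i hi => ?_
    obtain ⟨D', -, rfl⟩ := hi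
    exact hv'ι D'
  rw [himg]
  exact (centre_of_members.span_image_labels_eq v ι hιD A hA).symm

end SNCWithAt

/-- **The global form**: normal crossings with `C` need only be checked at the points of `V(C)`. [folklore] -/
theorem hasSNCWith_of_pointwise {X : Scheme.{u}} {ℬ : List X.IdealSheafData} {C : X.IdealSheafData}
    (hℬ : HasSNC ℬ) (h : ∀ x ∈ C.support, SNCWithAt ℬ C x) : HasSNCWith ℬ C :=
  hasSNCWith_of_forall_sncWithAt fun x => by
    by_cases hx : x ∈ C.support
    · exact h x hx
    · exact (hℬ.sncWithAt x).of_not_mem_support hx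


end DepthSNC

end Summit.ResolutionOfSingularities.ResolutionOfSingularities.Theorems

end
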